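import Summits.Ventures.CertifiedManyBodySolver.Observables.PairLROTowerWitnessGroundState
import Literature.MathematicalPhysics.QuantumLattice.TorusLimitSectorGroundStatesChargedRows
import HarnessLib

/-!
# The tower-witness torus limits are ground states of `H^{tt'} − μN` at EVERY `μ` of the subdifferential:
# a ground-state-complete one-point bound at ONE certified `μc ∈ [μ₋(n), μ₊(n)]` is the ceiling `liminf u_k ≤ M²`

HONEST FRAMING: soundness ("licence") theorems for a CEILING route at positivity scale; a ceiling never speaks to
the presence of pairing; not a superconductivity verdict; nothing in this file is a number. Crew hubbard-obs
(D-0042), seat hubbard-obs-gs-2 (`prover-hubbard-obs-gs-2-g3-0`). Zero compute; no definition; no named fact;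
no `sorry`.

`PairLROTowerWitnessGroundState.lean` located the supporting chemical potential of the Koma–Tasaki tower-witness
limits in the subdifferential `[μ₋(n), μ₊(n)]` EXISTENTIALLY, so its reading
`liminf_pairFieldLRO_le_sq_of_groundState_onePoint_bound` asks for the one-point bound at EVERY `μ` of the
subdifferential. But the WHOLE subdifferential supports a fixed-density minimiser (Literature
`IsTranslationInvariant.isMeanEnergyMinimiser_hubbardTTPrimeMu_of_mem_Icc`: chord inequality + Legendre floor), so:

* **`exists_torusLimit_towerWitness_groundState_forall_mem_Icc`** — the tower-witness torus limit `ω` of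
  `exists_torusLimit_towerWitness_groundState` is a mean-energy minimiser AND a Bratteli–Robinson ground state of
  `hubbardTTPrimeMuInteraction t t' U μ` for EVERY `μ ∈ [μ₋(n), μ₊(n)]` (with `Re ω(Φ₀^g) ≥ (k/(k+1))√c₀`).
* **`liminf_pairFieldLRO_le_sq_of_groundState_onePoint_bound_at`** — THE GROUND-STATE-COMPLETE ONE-POINT
  READING AT ONE CHEMICAL POTENTIAL: if for ONE `μc ∈ [μ₋(n), μ₊(n)]` every translation-invariant `ω` of density
  `n` that is a minimiser and a ground state of `H^{tt'} − μc N` has `Re ω(Φ₀^g) ≤ M`, then every family of unit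
  sector ground states has `liminf_k u_k ≤ M²`. This is the exact analogue, for the full ground-state row class
  (stationarity + every PSD KKT block over arbitrary generators), of the charged-stationarity reading
  `liminf_pairFieldLRO_le_sq_of_onePoint_chargedStationary_bound_TT'` (one `μc` in the bracket); when only a
  certified envelope `[hlo, hhi] ⊇ [μ₋(n), μ₊(n)]` is known, a cover by cells discharges the hypothesis as in the
  OP1-C Stage-B program; at a certified charge gap (e.g. half filling) a single interior `μc` suffices.
* `ObsPairLROCeilingAt_of_groundState_onePoint_bound_at` — registry consumer (`t = 1`, `g = g_d`).

References: T. Koma, H. Tasaki, J. Stat. Phys. 76 (1994) 745–803, §2.2 and Theorem 5 [KomaTasaki1994];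
O. Bratteli, A. Kishimoto, D. W. Robinson, Commun. Math. Phys. 64 (1978) 41–48, Thm. 2
[BratteliKishimotoRobinson1978]; D. Ruelle, *Statistical Mechanics: Rigorous Results* (1969) §3.4 [Ruelle1969].
-/

noncomputable section

namespace Summit.Ventures.CertifiedManyBodySolver.Observables

open Matrix Complex Finset Literature.MathematicalPhysics.QuantumLattice Literature.Probability.LatticeModels
open Literature.MathematicalPhysics.QuantumLattice.HubbardWave0 ThermodynamicLimit Filter Topology
open Literature.MathematicalPhysics.QuantumManyBody.StateRelaxation
open scoped ComplexOrder ComplexConjugate BigOperators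

section Family

variable (g : Site 2 → ℝ)

/-- **The tower-witness torus limits are minimisers and ground states of `H^{tt'} − μN` for EVERY `μ` in the
subdifferential.** Hypotheses as in `exists_torusLimit_towerWitness_groundState` (`U ≥ 0`, `0 < n < 2`, unit
`(rectN n L, S^z = 0)`-sector ground states with pair LRO `c₀L_j⁴ ≤ Re⟨ψ, Δ_g†Δ_g ψ⟩` eventually along `L_j → ∞`,
tower height `k`): the limit `ω` is translation invariant of density `n` and mean energy `e(t,t',U,n)`, has
`Re ω(Φ₀^g) ≥ (k/(k+1))√c₀`, and for every `μ ∈ [μ₋(n), μ₊(n)]` it is a mean-energy minimiser and a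
Bratteli–Robinson ground state of `hubbardTTPrimeMuInteraction t t' U μ`.
[cite: KomaTasaki1994, §2.2 and Theorem 5] [cite: Ruelle1969, §3.4] -/
theorem exists_torusLimit_towerWitness_groundState_forall_mem_Icc (t t' : ℝ) {U n : ℝ} (hU : 0 ≤ U)
    (hn0 : 0 < n) (hn2 : n < 2) (ψ : ∀ L, Fock (Orb (FermionTorus 2 L)))
    (hψ : ∀ L, IsGroundStateInSector (hubbardTorusTT' L t t' U) (rectN n L) 0 (ψ L))
    (hψ1 : ∀ L, star (ψ L) ⬝ᵥ ψ L = 1) {Ls : ℕ → ℕ} [hLne : ∀ j, NeZero (Ls j)]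
    (hLs : Tendsto Ls atTop atTop) {c₀ : ℝ} (hc₀ : 0 < c₀)
    (hlro : ∀ᶠ j in atTop, c₀ * (Ls j : ℝ) ^ 4 ≤
      (expect ((pairField g (Ls j))ᴴ * pairField g (Ls j)) (ψ (Ls j))).re) (k : ℕ) :
    ∃ (Ξ : ∀ L, Fock (Orb (FermionTorus 2 L))) (φ : ℕ → ℕ) (ω : InfVolFermionState 2),
      StrictMono φ ∧ ω.IsTorusLimitOf Ξ (Ls ∘ φ) ∧ ω.IsTranslationInvariant ∧ ω.density = n ∧
      ω.meanEnergy (hubbardTTPrimeFermionInteraction t t' U) 1 = energyDensityTT' t t' U n ∧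
      (∀ μ ∈ Set.Icc (chemPotMinusTT' t t' U n) (chemPotPlusTT' t t' U n),
        ω.IsMeanEnergyMinimiser (hubbardTTPrimeMuInteraction t t' U μ) 1 ∧
        ω.IsGroundState (hubbardTTPrimeMuInteraction t t' U μ) 1) ∧
      (k : ℝ) / (k + 1) * Real.sqrt c₀ ≤
        (ω.expect (pairRegion (insert (0 : Site 2) unitSteps) 0)
          (localPairAt (insert (0 : Site 2) unitSteps) g 0)).re := by
  obtain ⟨Ξ, φ, ω, -, hφ, hω, hTI, hρ, hme, -, -, -, hamp⟩ :=
    exists_torusLimit_towerWitness_groundState g t t' hU hn0 hn2 ψ hψ hψ1 hLs hc₀ hlro k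
  exact ⟨Ξ, φ, ω, hφ, hω, hTI, hρ, hme, fun μ hμ =>
    ⟨hTI.isMeanEnergyMinimiser_hubbardTTPrimeMu_of_mem_Icc t t' hU hn0 hn2 hρ hme hμ,
      hTI.isGroundState_hubbardTTPrimeMu_of_mem_Icc t t' hU hn0 hn2 hρ hme hμ⟩, hamp⟩

/-- **The ground-state-complete one-point reading at ONE chemical potential.** `U ≥ 0`, `0 < n < 2`,
`μc ∈ [μ₋(n), μ₊(n)]`. If `Re ω(Φ₀^g) ≤ M` for every translation-invariant state `ω` of density `n` that is a
mean-energy minimiser and a Bratteli–Robinson ground state of `hubbardTTPrimeMuInteraction t t' U μc` — the class in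
which every ground-state row of `H^{tt'} − μc N` (stationarity; PSD KKT blocks over arbitrary, also charged,
generators) and every translation-invariant-state row is valid — then every family of unit
`(rectN n L, S^z = 0)`-sector ground states of `hubbardTorusTT' L t t' U` has `liminf_k u_k ≤ M²` on the summit's
pair-LRO sequence (sharp Koma–Tasaki constant). [cite: KomaTasaki1994, Theorem 5] [cite: BratteliKishimotoRobinson1978, Thm. 2 (p. 47)] -/
theorem liminf_pairFieldLRO_le_sq_of_groundState_onePoint_bound_at (t t' : ℝ) {U n : ℝ} (hU : 0 ≤ U)
    (hn0 : 0 < n) (hn2 : n < 2) {μc : ℝ}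
    (hμc : μc ∈ Set.Icc (chemPotMinusTT' t t' U n) (chemPotPlusTT' t t' U n)) {M : ℝ}
    (hM : ∀ ω : InfVolFermionState 2, ω.IsTranslationInvariant → ω.density = n →
      ω.IsMeanEnergyMinimiser (hubbardTTPrimeMuInteraction t t' U μc) 1 →
      ω.IsGroundState (hubbardTTPrimeMuInteraction t t' U μc) 1 →
        (ω.expect (pairRegion (insert (0 : Site 2) unitSteps) 0)
          (localPairAt (insert (0 : Site 2) unitSteps) g 0)).re ≤ M)
    (ψ : ∀ L, Fock (Orb (FermionTorus 2 L)))
    (hψ : ∀ L, IsGroundStateInSector (hubbardTorusTT' L t t' U) (rectN n L) 0 (ψ L))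
    (hψ1 : ∀ L, star (ψ L) ⬝ᵥ ψ L = 1) :
    liminf (fun k : ℕ => (∑ x ∈ halfOpenBox 2 (2 * k), ∑ y ∈ halfOpenBox 2 (2 * k),
        torusPullback (pairFieldCorr g ψ) (2 * k) x y) / ((#(halfOpenBox 2 (2 * k)) : ℝ)) ^ 2) atTop ≤
      M ^ 2 := by
  set useq : ℕ → ℝ := fun k => (∑ x ∈ halfOpenBox 2 (2 * k), ∑ y ∈ halfOpenBox 2 (2 * k),
      torusPullback (pairFieldCorr g ψ) (2 * k) x y) / ((#(halfOpenBox 2 (2 * k)) : ℝ)) ^ 2 with huseq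
  change liminf useq atTop ≤ M ^ 2
  set vseq : ℕ → ℝ := fun m =>
    (expect ((pairField g (m + 1))ᴴ * pairField g (m + 1)) (ψ (m + 1))).re / (((m + 1 : ℕ) : ℝ)) ^ 4
    with hvseq
  have hterm : ∀ k : ℕ, 1 ≤ k → ∃ m : ℕ, 2 * k = m + 1 ∧ useq k = vseq m := by
    intro k hk
    obtain ⟨m, hm⟩ : ∃ m, 2 * k = m + 1 := ⟨2 * k - 1, by omega⟩
    refine ⟨m, hm, ?_⟩
    simp only [huseq, hvseq]
    rw [hm, torusLROSeq_pairFieldCorr_succ]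
  have hvnonneg : ∀ m : ℕ, 0 ≤ vseq m := fun m => by
    simp only [hvseq]
    refine div_nonneg ?_ (by positivity)
    exact (Complex.nonneg_iff.1
      ((Matrix.posSemidef_conjTranspose_mul_self (pairField g (m + 1))).dotProduct_mulVec_nonneg
        (ψ (m + 1)))).1
  have hnonneg : ∀ k : ℕ, 1 ≤ k → 0 ≤ useq k := fun k hk => by
    obtain ⟨m, -, heq⟩ := hterm k hk
    rw [heq]
    exact hvnonneg m
  have hbdd : IsBoundedUnder (· ≥ ·) atTop useq :=
    isBoundedUnder_of_eventually_ge (a := 0) (Filter.eventually_atTop.2 ⟨1, fun k hk => hnonneg k hk⟩)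
  by_contra hcon
  rw [not_le] at hcon
  obtain ⟨c₀, hc₀M, hc₀lim⟩ := exists_between hcon
  have hc₀ : 0 < c₀ := lt_of_le_of_lt (sq_nonneg M) hc₀M
  have hev : ∀ᶠ k : ℕ in atTop, c₀ < useq k := eventually_lt_of_lt_liminf hc₀lim hbdd
  -- the tower height: `(kt/(kt+1))·√c₀ > M`
  have hsqrt_pos : 0 < Real.sqrt c₀ := Real.sqrt_pos.2 hc₀
  have hMlt : M < Real.sqrt c₀ := by
    have h1 : |M| < Real.sqrt c₀ := by
      rw [← Real.sqrt_sq_eq_abs]; exact Real.sqrt_lt_sqrt (sq_nonneg M) hc₀M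
    exact lt_of_le_of_lt (le_abs_self M) h1
  obtain ⟨kt, hkt⟩ : ∃ kt : ℕ, M < (kt : ℝ) / (kt + 1) * Real.sqrt c₀ := by
    set δ : ℝ := 1 - M / Real.sqrt c₀ with hδ
    have hδpos : 0 < δ := by
      rw [hδ, sub_pos, div_lt_one hsqrt_pos]; exact hMlt
    obtain ⟨kt, hkt⟩ := exists_nat_gt (1 / δ)
    refine ⟨kt, ?_⟩
    have hk1 : (0 : ℝ) < kt + 1 := by positivity
    have h1 : 1 / ((kt : ℝ) + 1) < δ := by
      rw [div_lt_iff₀ hk1]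
      have : 1 / δ * δ = 1 := by field_simp
      nlinarith [hkt, hδpos]
    have h2 : (kt : ℝ) / (kt + 1) = 1 - 1 / (kt + 1) := by field_simp; ring
    rw [h2]
    have h3 : M / Real.sqrt c₀ < 1 - 1 / ((kt : ℝ) + 1) := by rw [hδ] at h1; linarith
    have := (div_lt_iff₀ hsqrt_pos).1 h3
    linarith
  -- the LRO floor along the sides `m + 2` (all sides from `2` on; the even ones carry the sequence)
  -- we use the side sequence `Ls j = 2 * (j + 1)`, written as `(2 * j + 1) + 1`
  set Ls : ℕ → ℕ := fun j => (2 * j + 1) + 1 with hLs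
  haveI hLne : ∀ j, NeZero (Ls j) := fun j => ⟨by simp [hLs]⟩
  have hLs_top : Tendsto Ls atTop atTop := by
    refine tendsto_atTop_mono (fun j => ?_) tendsto_id
    simp only [hLs, id]; omega
  have hlro : ∀ᶠ j in atTop, c₀ * (Ls j : ℝ) ^ 4 ≤
      (expect ((pairField g (Ls j))ᴴ * pairField g (Ls j)) (ψ (Ls j))).re := by
    have hev' : ∀ᶠ j : ℕ in atTop, c₀ < useq (j + 1) := (tendsto_add_atTop_nat 1).eventually hev
    filter_upwards [hev'] with j hj
    obtain ⟨m, hm, heq⟩ := hterm (j + 1) (by omega)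
    have hmj : m = 2 * j + 1 := by omega
    rw [heq] at hj
    simp only [hvseq] at hj
    have h := hj.le
    rw [le_div_iff₀ (by positivity)] at h
    subst hmj
    exact h
  obtain ⟨Ξ, φ, ω, -, -, hTI, hρ, -, hall, hamp⟩ :=
    exists_torusLimit_towerWitness_groundState_forall_mem_Icc g t t' hU hn0 hn2 ψ hψ hψ1 hLs_top hc₀ hlro kt
  obtain ⟨hmin, hgs⟩ := hall μc hμc
  have hle := hM ω hTI hρ hmin hgs
  linarith

/-- **Registry consumer at one chemical potential.** At an anchor `(U, n, t')` of the `t–t'` model at `t = 1`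
(`U ≥ 0`, `0 < n < 2`), form factor `g_d`, and ONE `μc ∈ [μ₋(n), μ₊(n)]`: a one-point bound `Re ω(Φ₀^d) ≤ M` valid
for every translation-invariant ground state of `hubbardTTPrimeMuInteraction 1 tp U μc` (minimiser and
Bratteli–Robinson ground state) of density `n` gives the summit-format leaf `ObsPairLROCeilingAt tp U n c'` for every
rational `c' ≥ M²`. [cite: KomaTasaki1994, Theorem 5] -/
theorem ObsPairLROCeilingAt_of_groundState_onePoint_bound_at {tp U n : ℝ} (hU : 0 ≤ U) (hn0 : 0 < n)
    (hn2 : n < 2) {μc : ℝ} (hμc : μc ∈ Set.Icc (chemPotMinusTT' 1 tp U n) (chemPotPlusTT' 1 tp U n))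
    {M : ℝ} {c' : ℚ}
    (hM : ∀ ω : InfVolFermionState 2, ω.IsTranslationInvariant → ω.density = n →
      ω.IsMeanEnergyMinimiser (hubbardTTPrimeMuInteraction 1 tp U μc) 1 →
      ω.IsGroundState (hubbardTTPrimeMuInteraction 1 tp U μc) 1 →
        (ω.expect (pairRegion (insert (0 : Site 2) unitSteps) 0)
          (localPairAt (insert (0 : Site 2) unitSteps) dWaveFormFactor 0)).re ≤ M)
    (hc' : M ^ 2 ≤ (c' : ℝ)) :
    ObsPairLROCeilingAt tp U n c' := by
  intro ψ hψ hψ1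
  exact (liminf_pairFieldLRO_le_sq_of_groundState_onePoint_bound_at dWaveFormFactor 1 tp hU hn0 hn2 hμc hM ψ
    hψ hψ1).trans hc'

end Family

end Summit.Ventures.CertifiedManyBodySolver.Observables

end
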